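import Summits.HodgeConjecture.CorCM.IrreducibleOddWeightsRightIdeals
import Summits.HodgeConjecture.CorCM.IrreducibleOddWeightsShadowIdeals
import HarnessLib

/-!
# Right ideals, III: the exact defect on a PIVOT — fibre sums of matrix coefficients, right-invariance, and
# `dim Hg(A₀) + dim Hg(A₁) − dim Hg(A₀ × A₁) = dim(F₀ ∩ F₁) = dim(w₀ℚ[Γ] ∩ w₁ℚ[Γ])`

COR-CM (cell `pub-hodgecm2`, binder seat `b16` gen 64, count-neutral claim RIGHT IDEALS, file R3 — abstract `G`-set
level; theorems only, no definition, no named fact, no `sorry`).  NEW as stated, hence under `Summits/`.  HONEST FRAMING: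
finite-dimensional linear algebra about the Kubota–Dodson rank of a pair of CM types (`dim Hg(A₀ × A₁)` versus
`dim Hg(A₀) + dim Hg(A₁)`); `HC_CM` is neither used nor asserted.

SETTING (R1 `IrreducibleOddWeightsRightIdeals`; gen 63 S1–S3 `IrreducibleOddWeightsShadowIdeals{,Criterion,Hecke}`).
Two slots `E_{i₀}, E_{i₁}` with types `Φ_κ`, matrix-coefficient spaces `MC_κ = span{c_x : x ∈ E_{i_κ}} ≤ ℚ^G`,
`c_x(g) = u_κ(g·x)`; by R1, `dim Hg(A₀) + dim Hg(A₁) − dim Hg(A₀ × A₁) = dim(MC₀ ∩ MC₁)` EXACTLY.  A PIVOT: maps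
`r_κ : E_{i_κ} → Y` (restriction of embeddings to a common subfield `M`); the FIBRE SUMS `s_{κ,y} = Σ_{r_κ x = y} c_x`
(`s_{κ,y}(g) = w_κ(g·y)` for the shadow `w_κ = (r_κ)_* u_κ` when `r_κ` is equivariant) span `F_κ ≤ MC_κ`.

* §1 **`span_fibreSum_le_span_coeff`** (`F ≤ MC`, nothing assumed) and the quantitative form of S1/S3's obstruction:
  **`typeRank_sigmaType_add_one_add_finrank_inf_fibreSum_le`** — `rank(Φ₀,Φ₁) + 1 + dim(F₀ ∩ F₁) ≤ rank Φ₀ + rank Φ₁`: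
  every independent common combination of fibre sums (of Hecke translates of the shadows) lowers `dim Hg(A₀ × A₁)` by one.
* §2 **`mem_span_fibreSum_of_forall_apply_mul_eq`** — THE AVERAGING LEMMA: if a subgroup `N ≤ G` is transitive on
  every fibre of `r` (each fibre lies in one `N`-orbit), then every `c ∈ MC` which is RIGHT-`N`-INVARIANT
  (`c(gn) = c(g)`) lies in `F` (average the coefficient vector of `c` over the finite image of `N` in `Sym(E)`: the
  average is constant on fibres).  **`apply_mul_eq_of_mem_span_coeff`** — every `c ∈ MC_κ` is right-invariant under
  the POINTWISE stabiliser of `E_{i_κ}` (`c_x(gn) = u(g·n·x) = c_x(g)`).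
* §3 **`span_coeff_inf_eq_span_fibreSum_inf`** — THE TRANSFER: if `N` is transitive on the fibres of `r₀` and of `r₁`
  (S1's (H1)) and lies in the subgroup generated by the two pointwise stabilisers (S1's (H2): for `Aut(ℂ)` and
  `Y = Hom(M, ℂ)`, `N = Aut(ℂ/z₀M)` and the Galois closures meet inside `z₀(M)`), then **`MC₀ ∩ MC₁ = F₀ ∩ F₁`** —
  an element of `MC₀ ∩ MC₁` is right-invariant under both pointwise stabilisers, hence under `N`, hence a combination of
  fibre sums on both sides.  Hence **`typeRank_add_typeRank_eq_of_pivot`**: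
  `rank Φ₀ + rank Φ₁ = rank(Φ₀, Φ₁) + 1 + dim(F₀ ∩ F₁)`, i.e. **`dim Hg(A₀) + dim Hg(A₁) − dim Hg(A₀ × A₁) = dim(F₀ ∩ F₁)`**
  — the EXACT version of S2/S3's criterion (which is the case `F₀ ∩ F₁ = 0`), with NO surjectivity of `r_κ`, NO
  irreducible representations and NO Schur lemma: only right-invariance and an average.
* File R3b `IrreducibleOddWeightsRightIdealsHecke` — THE HECKE READING on a torsor (`G` transitive on `Y`, maps
  `q_σ : Y → Y` commuting with `G`, `{q_σ y₀} = Y`): `dim Hg(A₀) + dim Hg(A₁) − dim Hg(A₀ × A₁) =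
  dim(span{w₀ ∘ q_σ} ∩ span{w₁ ∘ q_σ}) = dim(w₀ℚ[Γ] ∩ w₁ℚ[Γ])`; CM dress: R4 `IrreducibleOddWeightsRightIdealsPivotCMFields`.

## References

* [Deligne1982HodgeCycles] P. Deligne, *Hodge cycles on abelian varieties*, LNM 900 (1982), I.3.4, I.5 (p. 53), I Ex. 3.7.
* [Gordon1999HodgeAVSurvey] B. B. Gordon, *A survey of the Hodge conjecture for abelian varieties*, §3 Theorem (Imai,
  Murty) with proof, 7.5–7.7, 9.4.3.
* [Kubota1965] T. Kubota, *On the field extension by complex multiplication*, Trans. AMS 118 (1965), §2, §4.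
* [Serre1977] J.-P. Serre, *Linear Representations of Finite Groups*, GTM 42, §2.2, §3.3 (averaging).
* [Shimura1998] G. Shimura, *Abelian Varieties with Complex Multiplication and Modular Functions*, §8.1, §8.3.
-/

set_option autoImplicit false

noncomputable section

open scoped BigOperators

universe u v v' w

namespace Summit.HodgeConjecture.CorCM.IrrOdd

open Literature.NumberTheory.ComplexMultiplication

variable {G : Type w} [Group G]

/-! ### §1 Fibre sums of matrix coefficients -/

section FibreSum

variable {X : Type v} [MulAction G X] [Fintype X] {Y : Type v'} [DecidableEq Y]

omit [Fintype X] in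
/-- `u_{gn}(x) = u_g(n·x)`. [cite: Kubota1965, §2] -/
theorem antiVec_mul_apply (Φ : Set X) (g n : G) (x : X) : antiVec Φ (g * n) x = antiVec Φ g (n • x) := by
  simp only [antiVec, translateInd_mul]

/-- The fibre sum as a sum of matrix coefficients: `s_y = Σ_{r x = y} c_x` in `ℚ^G`. [folklore] -/
theorem fibreSum_eq_sum_coeff (Φ : Set X) (r : X → Y) (y : Y) :
    (fun g : G => ∑ x ∈ Finset.univ.filter (fun x => r x = y), antiVec Φ g x) =
      ∑ x ∈ Finset.univ.filter (fun x => r x = y), (fun g : G => antiVec Φ g x) := by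
  funext g
  simp only [Finset.sum_apply]

/-- **`F ≤ MC`**: the fibre sums of the matrix coefficients lie in the matrix-coefficient space (nothing assumed on `r`).
[cite: Gordon1999HodgeAVSurvey, §3 Theorem (proof)] -/
theorem span_fibreSum_le_span_coeff (Φ : Set X) (r : X → Y) :
    Submodule.span ℚ (Set.range fun y : Y => fun g : G =>
        ∑ x ∈ Finset.univ.filter (fun x => r x = y), antiVec Φ g x) ≤
      Submodule.span ℚ (Set.range fun x : X => fun g : G => antiVec Φ g x) := by
  rw [Submodule.span_le]
  rintro _ ⟨y, rfl⟩
  rw [SetLike.mem_coe]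
  dsimp only
  rw [fibreSum_eq_sum_coeff Φ r y]
  exact Submodule.sum_mem _ fun x _ => Submodule.subset_span ⟨x, rfl⟩

variable [MulAction G Y]

/-- For an EQUIVARIANT `r` the fibre sum at `y` is the matrix coefficient of the SHADOW `w = r_* u_1(Φ)`:
`s_y(g) = Σ_{r x = y} u_1(g·x) = Σ_{r x = g·y} u_1(x) = w(g·y)`. [cite: Shimura1998, §8.1] -/
theorem fibreSum_apply_eq_shadow_smul (Φ : Set X) (r : X → Y) (hr : ∀ (g : G) (x : X), r (g • x) = g • r x)
    (y : Y) (g : G) :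
    ∑ x ∈ Finset.univ.filter (fun x => r x = y), antiVec Φ g x =
      ∑ x ∈ Finset.univ.filter (fun x => r x = g • y), antiVec Φ (1 : G) x := by
  have h := sum_filter_comp_inv_smul r hr g⁻¹ (antiVec Φ (1 : G)) y
  simp only [inv_inv] at h
  rw [← h]
  exact Finset.sum_congr rfl fun x _ => antiVec_apply_eq_antiVec_one_smul Φ g x

end FibreSum

section Obstruction

variable {I : Type u} {E : I → Type v} [∀ i, MulAction G (E i)] [Fintype I] [∀ i, Fintype (E i)]
  [∀ i, Nonempty (E i)] {Y : Type v'} [DecidableEq Y]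

/-- **EVERY INDEPENDENT COMMON COMBINATION OF FIBRE SUMS LOWERS `dim Hg(A₀ × A₁)` BY ONE**:
`rank(Φ₀, Φ₁) + 1 + dim(F₀ ∩ F₁) ≤ rank Φ₀ + rank Φ₁` (no hypothesis on the maps `r_κ : E_{i_κ} → Y`) — the quantitative
form of the collision theorem of `IrreducibleOddWeightsShadowIdeals`. [cite: Gordon1999HodgeAVSurvey, §3 Theorem (proof) and 7.5] -/
theorem typeRank_sigmaType_add_one_add_finrank_inf_fibreSum_le {ρ : G} {Φ : ∀ i, Set (E i)}
    (h : ∀ i, IsCMTypeWith ρ (Φ i)) {i₀ i₁ : I} (hI : ∀ j, j = i₀ ∨ j = i₁) (h01 : i₀ ≠ i₁)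
    (r₀ : E i₀ → Y) (r₁ : E i₁ → Y) :
    typeRank G (sigmaType Φ) + 1 +
        Module.finrank ℚ (Submodule.span ℚ (Set.range fun y : Y => fun g : G =>
            ∑ x ∈ Finset.univ.filter (fun x => r₀ x = y), antiVec (Φ i₀) g x) ⊓
          Submodule.span ℚ (Set.range fun y : Y => fun g : G =>
            ∑ x ∈ Finset.univ.filter (fun x => r₁ x = y), antiVec (Φ i₁) g x) : Submodule ℚ (G → ℚ)) ≤
      typeRank G (Φ i₀) + typeRank G (Φ i₁) := by
  haveI := finite_span_coeff (G := G) (Φ i₀)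
  rw [typeRank_add_typeRank_eq_of_pair h hI h01]
  have hmono := Submodule.finrank_mono (inf_le_inf (span_fibreSum_le_span_coeff (G := G) (Φ i₀) r₀)
    (span_fibreSum_le_span_coeff (G := G) (Φ i₁) r₁))
  omega

end Obstruction

/-! ### §2 Right-invariance and the averaging lemma -/

section Averaging

variable {X : Type v} [MulAction G X] [Fintype X] {Y : Type v'} [DecidableEq Y]

omit [Fintype X] in
/-- **Matrix coefficients are right-invariant under the pointwise stabiliser of the slot**: `c(gn) = c(g)` for every
`c ∈ MC` and every `n` fixing `X` pointwise (`c_x(gn) = u_g(n·x) = c_x(g)`). [cite: Serre1977, §3.3] -/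
theorem apply_mul_eq_of_mem_span_coeff (Φ : Set X) {c : G → ℚ}
    (hc : c ∈ Submodule.span ℚ (Set.range fun x : X => fun g : G => antiVec Φ g x)) {n : G}
    (hn : ∀ x : X, n • x = x) (g : G) : c (g * n) = c g := by
  induction hc using Submodule.span_induction with
  | mem _ hx =>
    obtain ⟨x, rfl⟩ := hx
    change antiVec Φ (g * n) x = antiVec Φ g x
    rw [antiVec_mul_apply, hn]
  | zero => rfl
  | add _ _ _ _ h₁ h₂ => simp only [Pi.add_apply, h₁, h₂]
  | smul a _ _ h₁ => simp only [Pi.smul_apply, h₁]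

omit [Fintype X] in
/-- The right stabiliser `{n | ∀ g, c(gn) = c(g)}` of a function `c ∈ ℚ^G` is closed under the subgroup generated by any
set it contains. [folklore] -/
theorem forall_apply_mul_eq_of_mem_closure {c : G → ℚ} {S : Set G} (hS : ∀ n ∈ S, ∀ g : G, c (g * n) = c g)
    {n : G} (hn : n ∈ Subgroup.closure S) (g : G) : c (g * n) = c g := by
  induction hn using Subgroup.closure_induction generalizing g with
  | mem n hn => exact hS n hn g
  | one => rw [mul_one]
  | mul a b _ _ ha hb => rw [← mul_assoc, hb, ha]
  | inv a _ ha =>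
    have := ha (g * a⁻¹)
    rw [inv_mul_cancel_right] at this
    exact this.symm

/-- **THE AVERAGING LEMMA.**  `r : X → Y` any map, `N ≤ G` a subgroup TRANSITIVE ON EVERY FIBRE of `r` (each fibre lies in
one `N`-orbit).  If `c ∈ MC = span{c_x}` is right-`N`-invariant (`c(gn) = c(g)` for `n ∈ N`), then `c` lies in the span
`F` of the fibre sums `s_y = Σ_{r x = y} c_x`.  (Write `c = Σ_x a_x c_x`; right-invariance gives `c = Σ_x a(δx) c_x` for
every `δ` in the finite image `N̄` of `N` in `Sym(X)`; summing, `|N̄|·c = Σ_x A(x) c_x` with `A = Σ_δ a∘δ` constant on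
`N̄`-orbits, hence on fibres.) [cite: Serre1977, §3.3] -/
theorem mem_span_fibreSum_of_forall_apply_mul_eq (Φ : Set X) (r : X → Y) (N : Subgroup G)
    (hN : ∀ x x' : X, r x = r x' → ∃ n ∈ N, n • x = x') {c : G → ℚ}
    (hc : c ∈ Submodule.span ℚ (Set.range fun x : X => fun g : G => antiVec Φ g x))
    (hinv : ∀ n ∈ N, ∀ g : G, c (g * n) = c g) :
    c ∈ Submodule.span ℚ (Set.range fun y : Y => fun g : G =>
      ∑ x ∈ Finset.univ.filter (fun x => r x = y), antiVec Φ g x) := by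
  classical
  obtain ⟨a, rfl⟩ := (Submodule.mem_span_range_iff_exists_fun ℚ).1 hc
  -- the finite image `Γ` of `N` in `Sym(X)` and lifts of its elements
  let φ : G →* Equiv.Perm X := MulAction.toPermHom G X
  let Γ : Subgroup (Equiv.Perm X) := N.map φ
  haveI : Fintype Γ := Fintype.ofFinite Γ
  have hφ : ∀ (g : G) (x : X), φ g x = g • x := fun g x => rfl
  have hlift : ∀ δ : Γ, ∃ n : G, n ∈ N ∧ φ n = (δ : Equiv.Perm X) := fun δ => by
    obtain ⟨n, hn, hnδ⟩ := Subgroup.mem_map.1 δ.2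
    exact ⟨n, hn, hnδ⟩
  choose lift hliftN hliftφ using hlift
  -- (1) right-invariance: the coefficient vector may be translated by any `δ ∈ Γ`
  have h1 : ∀ δ : Γ, (∑ x, a x • fun g : G => antiVec Φ g x) =
      ∑ x, a ((δ : Equiv.Perm X) x) • fun g : G => antiVec Φ g x := by
    intro δ
    funext g
    have hg := hinv (lift δ)⁻¹ (N.inv_mem (hliftN δ)) g
    rw [← hg]
    simp only [Finset.sum_apply, Pi.smul_apply, smul_eq_mul, antiVec_mul_apply]
    refine Fintype.sum_equiv (MulAction.toPerm ((lift δ)⁻¹ : G)) _ _ fun x => ?_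
    rw [MulAction.toPerm_apply]
    congr 2
    rw [← hφ, map_inv, hliftφ δ, Equiv.Perm.inv_def, Equiv.apply_symm_apply]
  -- (2) summing over `Γ`: `|Γ| • c = Σ_x A(x) • c_x`, `A(x) = Σ_δ a(δ x)`
  have h2 : (Fintype.card Γ : ℚ) • (∑ x, a x • fun g : G => antiVec Φ g x) =
      ∑ x, (∑ δ : Γ, a ((δ : Equiv.Perm X) x)) • fun g : G => antiVec Φ g x := by
    rw [Nat.cast_smul_eq_nsmul, ← Finset.card_univ, ← Finset.sum_const, Finset.sum_congr rfl fun δ _ => h1 δ,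
      Finset.sum_comm]
    exact Finset.sum_congr rfl fun x _ => Finset.sum_smul.symm
  -- (3) `A` is constant on the fibres of `r`
  have h3 : ∀ x x' : X, r x = r x' → (∑ δ : Γ, a ((δ : Equiv.Perm X) x)) = ∑ δ : Γ, a ((δ : Equiv.Perm X) x') := by
    intro x x' hxx'
    obtain ⟨n, hn, rfl⟩ := hN x x' hxx'
    let δ₀ : Γ := ⟨φ n, Subgroup.mem_map.2 ⟨n, hn, rfl⟩⟩
    have hδ₀ : ∀ δ : Γ, (δ : Equiv.Perm X) (n • x) = ((δ * δ₀ : Γ) : Equiv.Perm X) x := fun δ => rfl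
    simp only [hδ₀]
    exact (Fintype.sum_equiv (Equiv.mulRight δ₀) _ _ fun δ => rfl).symm
  -- (4) hence `Σ_x A(x) • c_x` is a combination of fibre sums
  have h4 : (∑ x, (∑ δ : Γ, a ((δ : Equiv.Perm X) x)) • fun g : G => antiVec Φ g x) ∈
      Submodule.span ℚ (Set.range fun y : Y => fun g : G =>
        ∑ x ∈ Finset.univ.filter (fun x => r x = y), antiVec Φ g x) := by
    rw [← Finset.sum_fiberwise_of_maps_to (g := r) (t := Finset.univ.image r) fun x _ =>
      Finset.mem_image_of_mem r (Finset.mem_univ x)]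
    refine Submodule.sum_mem _ fun y _ => ?_
    by_cases hy : ∃ x₀, r x₀ = y
    · obtain ⟨x₀, hx₀⟩ := hy
      have hconst : ∀ x ∈ Finset.univ.filter (fun x => r x = y),
          (∑ δ : Γ, a ((δ : Equiv.Perm X) x)) • (fun g : G => antiVec Φ g x) =
            (∑ δ : Γ, a ((δ : Equiv.Perm X) x₀)) • (fun g : G => antiVec Φ g x) := by
        intro x hx
        rw [h3 x x₀ ((Finset.mem_filter.1 hx).2.trans hx₀.symm)]
      rw [Finset.sum_congr rfl hconst, ← Finset.smul_sum, ← fibreSum_eq_sum_coeff]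
      exact Submodule.smul_mem _ _ (Submodule.subset_span ⟨y, rfl⟩)
    · have hempty : Finset.univ.filter (fun x => r x = y) = ∅ :=
        Finset.filter_eq_empty_iff.2 fun x _ hx => hy ⟨x, hx⟩
      rw [hempty, Finset.sum_empty]
      exact Submodule.zero_mem _
  -- (5) divide by `|Γ| ≠ 0`
  have hcard : (Fintype.card Γ : ℚ) ≠ 0 := Nat.cast_ne_zero.2 Fintype.card_ne_zero
  rw [show (∑ x, a x • fun g : G => antiVec Φ g x) =
      (Fintype.card Γ : ℚ)⁻¹ • ((Fintype.card Γ : ℚ) • ∑ x, a x • fun g : G => antiVec Φ g x) from by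
    rw [smul_smul, inv_mul_cancel₀ hcard, one_smul]]
  rw [h2]
  exact Submodule.smul_mem _ _ h4

end Averaging

/-! ### §3 The transfer `MC₀ ∩ MC₁ = F₀ ∩ F₁` and the exact defect on the pivot -/

section Transfer

variable {I : Type u} {E : I → Type v} [∀ i, MulAction G (E i)] [Fintype I] [∀ i, Fintype (E i)]
  {Y : Type v'} [DecidableEq Y]

omit [Fintype I] in
/-- **THE TRANSFER `MC₀ ∩ MC₁ = F₀ ∩ F₁`.**  `r_κ : E_{i_κ} → Y` any maps; `N ≤ G` transitive on every fibre of `r₀` and of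
`r₁` and contained in the subgroup generated by the pointwise stabilisers of the two slots.  Then the common matrix
coefficients are exactly the common combinations of fibre sums: an element of `MC₀ ∩ MC₁` is right-invariant under both
pointwise stabilisers, hence under `N`, hence (averaging lemma) in `F₀` and in `F₁`.
[cite: Gordon1999HodgeAVSurvey, §3 Theorem (proof)] [cite: Serre1977, §3.3] -/
theorem span_coeff_inf_eq_span_fibreSum_inf (Φ : ∀ i, Set (E i)) {i₀ i₁ : I} (r₀ : E i₀ → Y) (r₁ : E i₁ → Y)
    (N : Subgroup G) (hN₀ : ∀ x x' : E i₀, r₀ x = r₀ x' → ∃ n ∈ N, n • x = x')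
    (hN₁ : ∀ x x' : E i₁, r₁ x = r₁ x' → ∃ n ∈ N, n • x = x')
    (hNcl : (N : Set G) ⊆ Subgroup.closure ({g : G | ∀ x : E i₀, g • x = x} ∪ {g : G | ∀ x : E i₁, g • x = x})) :
    Submodule.span ℚ (Set.range fun x : E i₀ => fun g : G => antiVec (Φ i₀) g x) ⊓
        Submodule.span ℚ (Set.range fun x : E i₁ => fun g : G => antiVec (Φ i₁) g x) =
      Submodule.span ℚ (Set.range fun y : Y => fun g : G =>
          ∑ x ∈ Finset.univ.filter (fun x => r₀ x = y), antiVec (Φ i₀) g x) ⊓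
        Submodule.span ℚ (Set.range fun y : Y => fun g : G =>
          ∑ x ∈ Finset.univ.filter (fun x => r₁ x = y), antiVec (Φ i₁) g x) := by
  refine le_antisymm ?_ (inf_le_inf (span_fibreSum_le_span_coeff (G := G) (Φ i₀) r₀)
    (span_fibreSum_le_span_coeff (G := G) (Φ i₁) r₁))
  rintro c ⟨hc₀, hc₁⟩
  -- right-invariance under the two pointwise stabilisers, hence under `N`
  have hS : ∀ n ∈ ({g : G | ∀ x : E i₀, g • x = x} ∪ {g : G | ∀ x : E i₁, g • x = x}), ∀ g : G,
      c (g * n) = c g := by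
    rintro n (hn | hn) g
    · exact apply_mul_eq_of_mem_span_coeff (Φ i₀) hc₀ hn g
    · exact apply_mul_eq_of_mem_span_coeff (Φ i₁) hc₁ hn g
  have hinv : ∀ n ∈ N, ∀ g : G, c (g * n) = c g := fun n hn g =>
    forall_apply_mul_eq_of_mem_closure hS (hNcl hn) g
  exact ⟨mem_span_fibreSum_of_forall_apply_mul_eq (Φ i₀) r₀ N hN₀ hc₀ hinv,
    mem_span_fibreSum_of_forall_apply_mul_eq (Φ i₁) r₁ N hN₁ hc₁ hinv⟩

variable [∀ i, Nonempty (E i)]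

/-- **THE EXACT DEFECT ON THE PIVOT: `rank Φ₀ + rank Φ₁ = rank(Φ₀, Φ₁) + 1 + dim(F₀ ∩ F₁)`**, i.e.
**`dim Hg(A₀) + dim Hg(A₁) − dim Hg(A₀ × A₁) = dim(F₀ ∩ F₁)`**, the dimension of the space of common combinations of the
FIBRE SUMS (Hecke translates of the shadows) — under (H1) `N` transitive on the fibres and (H2) `N` inside the subgroup
generated by the pointwise stabilisers; the criterion of `IrreducibleOddWeightsShadowIdealsCriterion` is its case `= 0`.
[cite: Gordon1999HodgeAVSurvey, §3 Theorem and 7.5–7.7] [cite: Deligne1982HodgeCycles, I.5 (p. 53)] -/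
theorem typeRank_add_typeRank_eq_of_pivot {ρ : G} {Φ : ∀ i, Set (E i)} (h : ∀ i, IsCMTypeWith ρ (Φ i))
    {i₀ i₁ : I} (hI : ∀ j, j = i₀ ∨ j = i₁) (h01 : i₀ ≠ i₁) (r₀ : E i₀ → Y) (r₁ : E i₁ → Y) (N : Subgroup G)
    (hN₀ : ∀ x x' : E i₀, r₀ x = r₀ x' → ∃ n ∈ N, n • x = x')
    (hN₁ : ∀ x x' : E i₁, r₁ x = r₁ x' → ∃ n ∈ N, n • x = x')
    (hNcl : (N : Set G) ⊆ Subgroup.closure ({g : G | ∀ x : E i₀, g • x = x} ∪ {g : G | ∀ x : E i₁, g • x = x})) :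
    typeRank G (Φ i₀) + typeRank G (Φ i₁) = typeRank G (sigmaType Φ) + 1 +
      Module.finrank ℚ (Submodule.span ℚ (Set.range fun y : Y => fun g : G =>
            ∑ x ∈ Finset.univ.filter (fun x => r₀ x = y), antiVec (Φ i₀) g x) ⊓
          Submodule.span ℚ (Set.range fun y : Y => fun g : G =>
            ∑ x ∈ Finset.univ.filter (fun x => r₁ x = y), antiVec (Φ i₁) g x) : Submodule ℚ (G → ℚ)) := by
  rw [typeRank_add_typeRank_eq_of_pair h hI h01, span_coeff_inf_eq_span_fibreSum_inf Φ r₀ r₁ N hN₀ hN₁ hNcl]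

/-- **`Hg(A₀ × A₁) = Hg(A₀) × Hg(A₁)` iff `F₀ ∩ F₁ = 0`** (under (H1), (H2)) — the criterion of
`IrreducibleOddWeightsShadowIdealsCriterion` recovered without surjectivity of the `r_κ` and without representation
theory. [cite: Gordon1999HodgeAVSurvey, §3 Theorem and 7.5–7.7] -/
theorem typeRank_sigmaType_add_card_eq_iff_inf_fibreSum_eq_bot {ρ : G} {Φ : ∀ i, Set (E i)}
    (h : ∀ i, IsCMTypeWith ρ (Φ i)) {i₀ i₁ : I} (hI : ∀ j, j = i₀ ∨ j = i₁) (h01 : i₀ ≠ i₁)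
    (r₀ : E i₀ → Y) (r₁ : E i₁ → Y) (N : Subgroup G)
    (hN₀ : ∀ x x' : E i₀, r₀ x = r₀ x' → ∃ n ∈ N, n • x = x')
    (hN₁ : ∀ x x' : E i₁, r₁ x = r₁ x' → ∃ n ∈ N, n • x = x')
    (hNcl : (N : Set G) ⊆ Subgroup.closure ({g : G | ∀ x : E i₀, g • x = x} ∪ {g : G | ∀ x : E i₁, g • x = x})) :
    typeRank G (sigmaType Φ) + Fintype.card I = (∑ i, typeRank G (Φ i)) + 1 ↔
      Submodule.span ℚ (Set.range fun y : Y => fun g : G =>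
            ∑ x ∈ Finset.univ.filter (fun x => r₀ x = y), antiVec (Φ i₀) g x) ⊓
          Submodule.span ℚ (Set.range fun y : Y => fun g : G =>
            ∑ x ∈ Finset.univ.filter (fun x => r₁ x = y), antiVec (Φ i₁) g x) = (⊥ : Submodule ℚ (G → ℚ)) := by
  rw [typeRank_sigmaType_add_card_eq_iff_inf_eq_bot_of_pair h hI h01,
    span_coeff_inf_eq_span_fibreSum_inf Φ r₀ r₁ N hN₀ hN₁ hNcl]

end Transfer

end Summit.HodgeConjecture.CorCM.IrrOdd

end
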